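import Literature.MathematicalPhysics.KineticTheory.EvenCollisionTubeFunctional
import HarnessLib

/-!
# Kinetic entropy balance functionals of a hard-sphere configuration (Résibois' split `H = H_K + H_C`)

Topic `Literature/MathematicalPhysics/KineticTheory` (definition item `defn-KineticEntropyBalanceFunctional`,
wanted by crux `stmt-AtomisticToContinuum-13081`, `JParityClosure.LocalSecondLaw`).  Companion of
`CollisionTubeFunctional.lean` / `EvenCollisionTubeFunctional.lean` (the vocabularies of the lines of 13078 /
13079): the tree home of the vocabulary of the crux line `resibois-offset-identity`, so that its seven
registered stubs can be stated from `Theorems/` files (a `Lines/` file is never imported).  All bodies are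
copied verbatim from the line's checked skeleton; only the names of the prelude fields change (below).

THE OBJECTS.  For `N + 1` hard spheres of diameter `ε = hsDiameter σ N` on `𝕋³`, one configuration `z`
(or a flow `Φ` and an initial datum), a space scale `r` (cone kernel `b_r = coneKernel r`) and a velocity
scale `ϑ` (Gaussian `G_ϑ = localMaxwellian 1 ϑ²`):

* prelude (namespace `Literature.MathematicalPhysics.KineticTheory`, next to the existing `coneKernel`,
  `mollDensity`): `mollMomentum` (`m_r`), `mollKineticEnergy` (`e_r`), `mollTemperature`
  (`θ_r = (2/3)(e_r/ρ_r − |m_r|²/(2ρ_r²))`), the guarded mathematical entropy density of the hard-sphere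
  fluid `hsEntropyDensity σ ρ θ = −ρ(3/2 log θ − log ρ − f_ex(ρσ³))` (`0` off `{ρ > 0, θ > 0}`) and the
  space–time entropy functional `hsEntropyFunctional σ r τ φ Φ z = ∫₀^τ∫ H(ρ_r,θ_r)(∂ₛφ + (m_r/ρ_r)·∇φ)`.
  These are the `cone/rhoC/momC/kinC/thetaC/Hs/entropyFunctional` of the problem-side file
  `Summits/…/Theorems/LocalSecondLaw/Negative/Functional.lean` with IDENTICAL bodies (so the two spellings
  agree by `rfl`), re-homed here because Literature never imports `Summits`.
* line vocabulary (sub-namespace `KineticEntropyBalance`, the line's names verbatim): `hm` (the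
  `(r,ϑ)`-mollified empirical one-body law), `hkin` (`∫ h log h dv`, CIP 1994 §3.4 (4.3)), `uC` (`m_r/ρ_r`),
  `klMaxwell` (relative entropy of `h(x,·)` w.r.t. its own moment-matched local Maxwellian), `HC`
  (configurational entropy density `a·f_ex(aσ³)`, the local-density form of the potential part of
  Résibois' `H`-functional for the modified Enskog equation), `c0 = (3/2)(log 2π + 1)`, `sDrop`
  (cone-smeared `φ`-weighted surprisal drop of one particle whose velocity jumps `w⁻ → w⁺`), `preVel`,
  `jump1`/`jump2` (one- and two-point smeared surprisal jumps of an ordered contact pair), `prodSum`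
  (`(2(N+1))⁻¹ Σ` over collision times in `[0,τ]` and ordered contact pairs — the collision sum of
  `EvenCollisionTubeFunctional` with weight `1/(2(N+1))` instead of `ε/(N+1)`), `P1`/`P2` (net one- and two-point
  surprisal production functionals), `confFunctional` (`∫∫ H_C(ρ_r)(∂ₛφ + u_r·∇φ)`), `kinFunctional`
  (`:= hsEntropyFunctional − confFunctional`), `initKin`, `initConf` (`s = 0` boundary terms), `klFunctional`
  (time–space integrated `klMaxwell` along a flow), `Regular` (floor/band/cap event at resolution `r` on
  `[0,τ] × 𝕋³`) and the J-even mark family `sMark k (n,v,w) = ((w−v)·n)₊((v+w)·n) n_k` (the collisional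
  transfer of kinetic energy times `n_k`, Chapman–Cowling §16.4/§16.6: `sMark_eq_of_inner_nonneg`).

API (all elementary): `hsEntropyDensity_of_pos/_of_not`, the pointwise Résibois split
`hsEntropyDensity = H_id + HC` on the guard branch, `hm_eq_sum`, `mollKineticEnergy_eq_sum`,
`kinFunctional_add_confFunctional` (the glue `kinF + confF = I` is `sub_add_cancel`), `jump2_sub_jump1`
(the Enskog OFFSET), `prodSum_sub` / `P2_sub_P1` (finitely many collision times), `sMark_eq_of_inner_nonneg`
/ `sMark_eq_zero_of_inner_nonpos`.

## References

* P. Résibois, J. Stat. Phys. 19 (1978) 593–609 (H-theorem for the modified Enskog equation: the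
  `H`-functional is the Boltzmann part `∫ f log f` plus a potential part fixed by the hard-sphere excess
  free energy).  [Resibois1978]
* C. Cercignani, R. Illner, M. Pulvirenti, *The Mathematical Theory of Dilute Gases* (1994), §3.2 (the
  Boltzmann inequality), §3.4 (`ℋ = ∫ f log f dξ` (4.3), entropy flux (4.4), local balance (4.2)).
  [CIPDiluteGases1994]
* H. Spohn, *Large Scale Dynamics of Interacting Particles* (1991), Part I §2.3 (local equilibrium
  states), Ch. 3 (the hydrodynamic limit: propagation of local equilibrium, Euler scaling).  [Spohn1991]
* S. Chapman, T. G. Cowling, *The Mathematical Theory of Non-Uniform Gases*, 3rd ed. (1970), Ch. 16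
  (§16.4 collisional transfer of molecular properties, §16.5 of momentum, §16.6 of energy).  [ChapmanCowling1970]

## Not here

No measurability, integrability or limit statement.  The line's two antecedent statements
(entropic Maxwellisation, even S-transfer), its seven stubs (floors, Maxwellisation, kinetic balance, net
production, S-transfer, offset, initial matching) and their composition are problem-side statements
(`Summits/AtomisticToContinuum/HydrodynamicLimit/…`).
-/

noncomputable section

open scoped BigOperators Classical InnerProductSpace ENNReal
open Set MeasureTheory
open Literature.Analysis.FluidPDE

namespace Literature.MathematicalPhysics.KineticTheory

variable {N : ℕ}

/-! ## Prelude: mollified empirical fields and the guarded entropy density (companions of `mollDensity`) -/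

/-- Mollified empirical momentum `m_r(x₀) = ∫ b_r(y, x₀) v dμ_z(y, v)` of one configuration (verbatim the
problem-side `momC`). [folklore] -/
def mollMomentum (r : ℝ) (z : Config (N + 1) (Fin 3) T3) (x₀ : T3) : V3 :=
  ∫ q, coneKernel r q.1 x₀ • q.2 ∂(empiricalMeasure z)

/-- Mollified empirical kinetic energy `e_r(x₀) = ∫ b_r(y, x₀) |v|²/2 dμ_z(y, v)` (verbatim the
problem-side `kinC`). [folklore] -/
def mollKineticEnergy (r : ℝ) (z : Config (N + 1) (Fin 3) T3) (x₀ : T3) : ℝ :=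
  ∫ q, coneKernel r q.1 x₀ * (‖q.2‖ ^ 2 / 2) ∂(empiricalMeasure z)

/-- Empirical temperature `θ_r = (2/3)(e_r/ρ_r − |m_r|²/(2ρ_r²))` (verbatim the problem-side `thetaC`;
junk division values where `ρ_r = 0`). [folklore] -/
def mollTemperature (r : ℝ) (z : Config (N + 1) (Fin 3) T3) (x₀ : T3) : ℝ :=
  2 / 3 * (mollKineticEnergy r z x₀ / mollDensity r z x₀ -
    ‖mollMomentum r z x₀‖ ^ 2 / (2 * mollDensity r z x₀ ^ 2))

/-- The guarded mathematical (negative physical) entropy density of the hard-sphere fluid,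
`H(ρ, θ) = −ρ(3/2 log θ − log ρ − f_ex(ρσ³))` on `{ρ > 0, θ > 0}` and `0` off it: ideal-gas part
`ρ log ρ − (3/2)ρ log θ` plus the configurational part `ρ f_ex(ρσ³)` (`hsEntropyDensity_eq_ideal_add_HC`;
verbatim the problem-side `Hs`, the `let H` of the crux `LocalSecondLaw`). [folklore] -/
def hsEntropyDensity (σ a b : ℝ) : ℝ :=
  if 0 < a ∧ 0 < b then -(a * (3 / 2 * Real.log b - Real.log a - hsExcessFreeEnergy (a * σ ^ 3))) else 0

/-- The space–time entropy functional `I(z) = ∫₀^τ ∫ H(ρ_r,θ_r)(∂ₛφ + (m_r/ρ_r)·∇φ) dx ds` along the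
hard-sphere flow `Φ` started at `z` (verbatim the problem-side `entropyFunctional`, definitionally the
`let`-tower of the crux `LocalSecondLaw`; Bochner integrals, junk `0` where not integrable). [folklore] -/
def hsEntropyFunctional (σ r τ : ℝ) (φ : ℝ → T3 → ℝ)
    (Φ : HardSphereFlow (Torus.geometry (Fin 3)) (hsDiameter σ N) (N + 1))
    (z : Config (N + 1) (Fin 3) T3) : ℝ :=
  ∫ s in Set.Icc (0 : ℝ) τ, ∫ x : T3,
    hsEntropyDensity σ (mollDensity r (Φ.flow s z) x) (mollTemperature r (Φ.flow s z) x) *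
      (deriv (fun s' => φ s' x) s +
        ∑ k : Fin 3, (mollMomentum r (Φ.flow s z) x) k / mollDensity r (Φ.flow s z) x *
          Literature.Analysis.FunctionSpaces.Torus.partialDeriv k (φ s) x)

namespace KineticEntropyBalance

/-! ## The mollified one-body law and its entropies -/

/-- The `(r,ϑ)`-mollified empirical one-body law `h(x₀,v) = ∫ b_r(y,x₀) G_ϑ(v − w) dμ_z(y,w)` (cone
kernel in space, Gaussian of variance `ϑ²` in velocity; verbatim the `hm` of `OddContactSymmetry` at one
configuration).  Mass `ρ_r(x₀)`, momentum `m_r(x₀)`, kinetic energy `e_r(x₀) + (3/2)ϑ²ρ_r(x₀)`. [folklore] -/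
def hm (r ϑ : ℝ) (z : Config (N + 1) (Fin 3) T3) (x₀ : T3) (v : V3) : ℝ :=
  ∫ q, coneKernel r q.1 x₀ * localMaxwellian 1 (ϑ ^ 2) v q.2 ∂(empiricalMeasure z)

/-- Kinetic entropy density `h_kin(x₀) = ∫ h log h dv` of the mollified law — Boltzmann's `H` density
`ℋ = ∫ f log f dξ`. [cite: CIPDiluteGases1994, §3.4 eq. (4.3)] -/
def hkin (r ϑ : ℝ) (z : Config (N + 1) (Fin 3) T3) (x₀ : T3) : ℝ :=
  ∫ v, hm r ϑ z x₀ v * Real.log (hm r ϑ z x₀ v)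

/-- Empirical velocity `u_r = m_r / ρ_r` (junk `0` where `ρ_r = 0`). [folklore] -/
def uC (r : ℝ) (z : Config (N + 1) (Fin 3) T3) (x₀ : T3) : V3 :=
  (mollDensity r z x₀)⁻¹ • mollMomentum r z x₀

/-- Relative entropy of `h(x₀,·)` with respect to ITS OWN local Maxwellian (same mass `ρ_r`, velocity
`u_r` and smoothed temperature `θ_r + ϑ²`): `∫ h log (h / M[h]) dv = h_kin − ∫ M[h] log M[h] ≥ 0`. [folklore] -/
def klMaxwell (r ϑ : ℝ) (z : Config (N + 1) (Fin 3) T3) (x₀ : T3) : ℝ :=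
  ∫ v, hm r ϑ z x₀ v *
    Real.log (hm r ϑ z x₀ v /
      localMaxwellian (mollDensity r z x₀) (mollTemperature r z x₀ + ϑ ^ 2) (uC r z x₀) v)

/-- Configurational entropy density `H_C(a) = a · f_ex(a σ³)` (unguarded; `H = H_id + H_C` on
`{ρ > 0, θ > 0}`, `hsEntropyDensity_eq_ideal_add_HC`): the local-density form of the potential part of
Résibois' `H`-functional for the modified Enskog equation. [cite: Resibois1978] -/
def HC (σ a : ℝ) : ℝ := a * hsExcessFreeEnergy (a * σ ^ 3)

/-- `c₀ = (3/2)(log 2π + 1)`: for a Maxwellian `∫ M log M dv = ρ log ρ − (3/2) ρ log θ − c₀ ρ = H_id(ρ,θ) − c₀ρ`.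
[folklore] -/
def c0 : ℝ := 3 / 2 * (Real.log (2 * Real.pi) + 1)

/-! ## Smeared surprisal jumps of a contact pair and the production functionals -/

/-- The CONE-SMEARED, `φ`-WEIGHTED SURPRISAL DROP of one particle whose velocity jumps `w⁻ → w⁺`, read with
the cone centred at `y`: `∫ b_r(y,x) φ(x) ∫ [G_ϑ(v − w⁻) − G_ϑ(v − w⁺)] log h(x,v) dv dx` — `(N+1)×` minus
the linearisation of the jump of `∫∫ φ h log h` caused by moving that particle's Gaussian, i.e. the literal
collision term of the exact kinetic-entropy balance. [folklore] -/
def sDrop (r ϑ : ℝ) (φs : T3 → ℝ) (z : Config (N + 1) (Fin 3) T3) (y : T3) (wpre wpost : V3) : ℝ :=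
  ∫ x, coneKernel r y x * φs x *
    ∫ v, (localMaxwellian 1 (ϑ ^ 2) wpre v - localMaxwellian 1 (ϑ ^ 2) wpost v) * Real.log (hm r ϑ z x v)

/-- Pre-collisional velocities of the ordered pair `(i, j)` recovered from the (right-continuous,
post-collisional) configuration by the involution `reflectVel` on the minimal-image separation. [folklore] -/
def preVel (w : Config (N + 1) (Fin 3) T3) (i j : Fin (N + 1)) : V3 × V3 :=
  reflectVel ((Torus.geometry (Fin 3)).sepVec (w i).1 (w j).1) ((w i).2, (w j).2)

/-- ONE-POINT smeared surprisal jump of the ordered contact pair `(i,j)`: BOTH partners' drops read around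
`xᵢ` (the cone-smeared form of the route's J-odd surprisal jump `F`). [folklore] -/
def jump1 (r ϑ : ℝ) (φs : T3 → ℝ) (w : Config (N + 1) (Fin 3) T3) (i j : Fin (N + 1)) : ℝ :=
  sDrop r ϑ φs w (w i).1 (preVel w i j).1 (w i).2 + sDrop r ϑ φs w (w i).1 (preVel w i j).2 (w j).2

/-- TWO-POINT smeared surprisal jump: each partner's drop read around ITS OWN position (`x_j = x_i − ε n̂`);
the exact first-order jump of the kinetic entropy.  `jump2 − jump1` is the Enskog OFFSET (`jump2_sub_jump1`,
`O(ε)` per collision). [folklore] -/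
def jump2 (r ϑ : ℝ) (φs : T3 → ℝ) (w : Config (N + 1) (Fin 3) T3) (i j : Fin (N + 1)) : ℝ :=
  sDrop r ϑ φs w (w i).1 (preVel w i j).1 (w i).2 + sDrop r ϑ φs w (w j).1 (preVel w i j).2 (w j).2

/-- The PER-UNIT-ENTROPY collision sum `(2(N+1))⁻¹ Σ_{collision times s ∈ [0,τ]} Σ_{ordered contact pairs} m`
along `s ↦ Φ.flow s z` — the collision sum `K_N` (`collisionSum`) with its Euler weight `ε/(N+1)` replaced
by `1/(2(N+1))` (`= (2ε)⁻¹ K_N`: a symmetric mark summed once per collision with weight `(N+1)⁻¹`).  The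
finsum is the junk `0` for infinitely many collision times in `[0,τ]` (off the good set of the flow). [folklore] -/
def prodSum (σ : ℝ) (N : ℕ) (Φ : HardSphereFlow (Torus.geometry (Fin 3)) (hsDiameter σ N) (N + 1)) (τ : ℝ)
    (m : Config (N + 1) (Fin 3) T3 → ℝ → Fin (N + 1) → Fin (N + 1) → ℝ)
    (z : Config (N + 1) (Fin 3) T3) : ℝ :=
  (2 * ((N : ℝ) + 1))⁻¹ *
    ∑ᶠ (s : ℝ) (_ : s ∈ collisionTimes (Torus.geometry (Fin 3)) (hsDiameter σ N) (fun s' => Φ.flow s' z) ∩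
        Set.Icc 0 τ),
      ∑ i : Fin (N + 1), ∑ j : Fin (N + 1),
        (if i ≠ j ∧ ‖(Torus.geometry (Fin 3)).sepVec (Φ.flow s z i).1 (Φ.flow s z j).1‖ = hsDiameter σ N then
          m (Φ.flow s z) s i j
        else 0)

/-- `P1` — one-point NET surprisal production functional (per unit entropy, `φ`-weighted, cone-smeared):
`prodSum` of the mark `jump1 r ϑ (φ s)`. [folklore] -/
def P1 (σ : ℝ) (N : ℕ) (Φ : HardSphereFlow (Torus.geometry (Fin 3)) (hsDiameter σ N) (N + 1))
    (τ r ϑ : ℝ) (φ : ℝ → T3 → ℝ) (z : Config (N + 1) (Fin 3) T3) : ℝ :=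
  prodSum σ N Φ τ (fun w s i j => jump1 r ϑ (φ s) w i j) z

/-- `P2` — two-point NET surprisal production functional (the literal collision term of the kinetic balance):
`prodSum` of the mark `jump2 r ϑ (φ s)`. [folklore] -/
def P2 (σ : ℝ) (N : ℕ) (Φ : HardSphereFlow (Torus.geometry (Fin 3)) (hsDiameter σ N) (N + 1))
    (τ r ϑ : ℝ) (φ : ℝ → T3 → ℝ) (z : Config (N + 1) (Fin 3) T3) : ℝ :=
  prodSum σ N Φ τ (fun w s i j => jump2 r ϑ (φ s) w i j) z

/-! ## The configurational / kinetic split of the entropy functional and the boundary terms -/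

/-- `confF` — the CONFIGURATIONAL part of the entropy functional: `∫₀^τ∫ H_C(ρ_r)(∂ₛφ + u_r·∇φ) dx ds`
(`u_r = m_r/ρ_r` componentwise, junk division where `ρ_r = 0`; Bochner integrals). [folklore] -/
def confFunctional (σ r τ : ℝ) (φ : ℝ → T3 → ℝ)
    (Φ : HardSphereFlow (Torus.geometry (Fin 3)) (hsDiameter σ N) (N + 1)) (z : Config (N + 1) (Fin 3) T3) : ℝ :=
  ∫ s in Set.Icc (0 : ℝ) τ, ∫ x : T3,
    HC σ (mollDensity r (Φ.flow s z) x) *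
      (deriv (fun s' => φ s' x) s +
        ∑ k : Fin 3, (mollMomentum r (Φ.flow s z) x) k / mollDensity r (Φ.flow s z) x *
          Literature.Analysis.FunctionSpaces.Torus.partialDeriv k (φ s) x)

/-- `kinF := I − confF` — the KINETIC (ideal-gas) part of the entropy functional `I = hsEntropyFunctional`,
DEFINED as the difference so that the split `kinF + confF = I` is `sub_add_cancel`
(`kinFunctional_add_confFunctional`); on the regular set it is `∫₀^τ∫ H_id(ρ_r,θ_r)(∂ₛφ + u_r·∇φ)`,
`H_id(a,b) = −a(3/2 log b − log a)`. [folklore] -/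
def kinFunctional (σ r τ : ℝ) (φ : ℝ → T3 → ℝ)
    (Φ : HardSphereFlow (Torus.geometry (Fin 3)) (hsDiameter σ N) (N + 1)) (z : Config (N + 1) (Fin 3) T3) : ℝ :=
  hsEntropyFunctional σ r τ φ Φ z - confFunctional σ r τ φ Φ z

/-- `initKin` — empirical KINETIC boundary term at `s = 0`: `∫ (h_kin + c₀ρ_r)(0,x) φ(0,x) dx`. [folklore] -/
def initKin (σ r ϑ : ℝ) (φ : ℝ → T3 → ℝ)
    (Φ : HardSphereFlow (Torus.geometry (Fin 3)) (hsDiameter σ N) (N + 1)) (z : Config (N + 1) (Fin 3) T3) : ℝ :=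
  ∫ x : T3, (hkin r ϑ (Φ.flow 0 z) x + c0 * mollDensity r (Φ.flow 0 z) x) * φ 0 x

/-- `initConf` — empirical CONFIGURATIONAL boundary term at `s = 0`: `∫ H_C(ρ_r(0,x)) φ(0,x) dx`. [folklore] -/
def initConf (σ r : ℝ) (φ : ℝ → T3 → ℝ)
    (Φ : HardSphereFlow (Torus.geometry (Fin 3)) (hsDiameter σ N) (N + 1)) (z : Config (N + 1) (Fin 3) T3) : ℝ :=
  ∫ x : T3, HC σ (mollDensity r (Φ.flow 0 z) x) * φ 0 x

/-- `klF` — time–space integrated relative entropy of the mollified law w.r.t. its own local Maxwellian,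
`∫₀^τ ∫ KL(h(s,x,·) ‖ M[h](s,x,·)) dx ds` along the flow. [folklore] -/
def klFunctional (σ r ϑ τ : ℝ)
    (Φ : HardSphereFlow (Torus.geometry (Fin 3)) (hsDiameter σ N) (N + 1)) (z : Config (N + 1) (Fin 3) T3) : ℝ :=
  ∫ s in Set.Icc (0 : ℝ) τ, ∫ x : T3, klMaxwell r ϑ (Φ.flow s z) x

/-- The REGULARITY EVENT at resolution `r` on `[0,τ] × 𝕋³`: density floor `ρ₁ ≤ ρ_r`, band `σ³ρ_r ≤ η₁`,
temperature floor `θ₁ ≤ θ_r`, kinetic-energy-density cap `e_r ≤ E₁` (whence `ρ_r ≤ 2E₁/(3θ₁)` and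
`|u_r|² ≤ 2E₁/ρ₁`), uniformly in `(s, x)`. [folklore] -/
def Regular (σ r τ η₁ ρ₁ θ₁ E₁ : ℝ)
    (Φ : HardSphereFlow (Torus.geometry (Fin 3)) (hsDiameter σ N) (N + 1)) (z : Config (N + 1) (Fin 3) T3) : Prop :=
  ∀ s ∈ Set.Icc (0 : ℝ) τ, ∀ x : T3,
    ρ₁ ≤ mollDensity r (Φ.flow s z) x ∧ σ ^ 3 * mollDensity r (Φ.flow s z) x ≤ η₁ ∧
      θ₁ ≤ mollTemperature r (Φ.flow s z) x ∧ mollKineticEnergy r (Φ.flow s z) x ≤ E₁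

/-- The J-even mark family `Ξ_S^k(n, v, w) = ((w − v)·n)₊ ((v + w)·n) n_k` (quadratic in the velocities).
At a unit normal with `(w − v)·n ≥ 0` it is the collisional transfer of kinetic energy to the first partner,
`|v′|² − |v|²` with `v′ = (reflectVel n (v, w)).1`, times `n_k` (`sMark_eq_of_inner_nonneg`): the mark of
the collisional energy flux of the dense hard-sphere gas. [cite: ChapmanCowling1970, §16.4 and §16.6] -/
def sMark (k : Fin 3) (q : V3 × V3 × V3) : ℝ :=
  max ⟪q.2.2 - q.2.1, q.1⟫_ℝ 0 * (⟪q.2.2 + q.2.1, q.1⟫_ℝ * q.1 k)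

end KineticEntropyBalance

/-! ## API (definitional unfoldings and elementary identities; no measurability or limit claims) -/

/-- The guard branch of the entropy density. [folklore] -/
theorem hsEntropyDensity_of_pos (σ : ℝ) {a b : ℝ} (ha : 0 < a) (hb : 0 < b) :
    hsEntropyDensity σ a b = -(a * (3 / 2 * Real.log b - Real.log a - hsExcessFreeEnergy (a * σ ^ 3))) := by
  unfold hsEntropyDensity
  rw [if_pos ⟨ha, hb⟩]

/-- The junk branch of the entropy density: `H(ρ, θ) = 0` off `{ρ > 0, θ > 0}`. [folklore] -/
theorem hsEntropyDensity_of_not (σ : ℝ) {a b : ℝ} (h : ¬(0 < a ∧ 0 < b)) : hsEntropyDensity σ a b = 0 := by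
  unfold hsEntropyDensity
  rw [if_neg h]

/-- **Résibois' split, pointwise**: on the guard branch `H(ρ, θ) = H_id(ρ, θ) + H_C(ρ)` with the ideal-gas
entropy density `H_id(ρ, θ) = −ρ(3/2 log θ − log ρ)` and `H_C(ρ) = ρ f_ex(ρσ³)`. [folklore] -/
theorem hsEntropyDensity_eq_ideal_add_HC (σ : ℝ) {a b : ℝ} (ha : 0 < a) (hb : 0 < b) :
    hsEntropyDensity σ a b = -(a * (3 / 2 * Real.log b - Real.log a)) + KineticEntropyBalance.HC σ a := by
  rw [hsEntropyDensity_of_pos σ ha hb]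
  unfold KineticEntropyBalance.HC
  ring

/-- The mollified kinetic energy as a finite sum over particles. [folklore] -/
theorem mollKineticEnergy_eq_sum (r : ℝ) (z : Config (N + 1) (Fin 3) T3) (x₀ : T3) :
    mollKineticEnergy r z x₀ = ((N + 1 : ℕ) : ℝ)⁻¹ * ∑ i, coneKernel r (z i).1 x₀ * (‖(z i).2‖ ^ 2 / 2) := by
  unfold mollKineticEnergy
  rw [integral_empiricalMeasure]

namespace KineticEntropyBalance

/-- The mollified one-body law as a finite sum over particles:
`h(x₀, v) = (N+1)⁻¹ Σᵢ b_r(xᵢ, x₀) G_ϑ(v − vᵢ)`. [folklore] -/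
theorem hm_eq_sum (r ϑ : ℝ) (z : Config (N + 1) (Fin 3) T3) (x₀ : T3) (v : V3) :
    hm r ϑ z x₀ v = ((N + 1 : ℕ) : ℝ)⁻¹ * ∑ i, coneKernel r (z i).1 x₀ * localMaxwellian 1 (ϑ ^ 2) v (z i).2 := by
  unfold hm
  rw [integral_empiricalMeasure]

/-- **The split of the entropy functional is definitional**: `kinF + confF = I`. [folklore] -/
theorem kinFunctional_add_confFunctional (σ r τ : ℝ) (φ : ℝ → T3 → ℝ)
    (Φ : HardSphereFlow (Torus.geometry (Fin 3)) (hsDiameter σ N) (N + 1)) (z : Config (N + 1) (Fin 3) T3) :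
    kinFunctional σ r τ φ Φ z + confFunctional σ r τ φ Φ z = hsEntropyFunctional σ r τ φ Φ z :=
  sub_add_cancel _ _

/-- **The Enskog offset of one contact pair**: `jump2 − jump1` is partner `j`'s smeared drop read around
its own position `x_j` minus the same drop read around `x_i`. [folklore] -/
theorem jump2_sub_jump1 (r ϑ : ℝ) (φs : T3 → ℝ) (w : Config (N + 1) (Fin 3) T3) (i j : Fin (N + 1)) :
    jump2 r ϑ φs w i j - jump1 r ϑ φs w i j =
      sDrop r ϑ φs w (w j).1 (preVel w i j).2 (w j).2 - sDrop r ϑ φs w (w i).1 (preVel w i j).2 (w j).2 := by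
  unfold jump2 jump1
  ring

/-- **Linearity of the collision sum in the mark** when finitely many collision times lie in `[0, τ]`
(always the case on the good set of the flow): `prodSum m₁ − prodSum m₂ = prodSum (m₁ − m₂)`. [folklore] -/
theorem prodSum_sub (σ : ℝ) (N : ℕ) (Φ : HardSphereFlow (Torus.geometry (Fin 3)) (hsDiameter σ N) (N + 1))
    (τ : ℝ) (m₁ m₂ : Config (N + 1) (Fin 3) T3 → ℝ → Fin (N + 1) → Fin (N + 1) → ℝ)
    (z : Config (N + 1) (Fin 3) T3)
    (hfin : (collisionTimes (Torus.geometry (Fin 3)) (hsDiameter σ N) (fun s' => Φ.flow s' z) ∩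
      Set.Icc 0 τ).Finite) :
    prodSum σ N Φ τ m₁ z - prodSum σ N Φ τ m₂ z =
      prodSum σ N Φ τ (fun w s i j => m₁ w s i j - m₂ w s i j) z := by
  unfold prodSum
  rw [← mul_sub, ← finsum_mem_sub_distrib _ _ hfin]
  congr 1
  refine finsum_congr fun s => finsum_congr fun _ => ?_
  rw [← Finset.sum_sub_distrib]
  refine Finset.sum_congr rfl fun i _ => ?_
  rw [← Finset.sum_sub_distrib]
  refine Finset.sum_congr rfl fun j _ => ?_
  split_ifs <;> simp

/-- **The offset functional**: with finitely many collision times in `[0, τ]`, `P2 − P1` is the collision sum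
of the offset marks `jump2 − jump1`. [folklore] -/
theorem P2_sub_P1 (σ : ℝ) (N : ℕ) (Φ : HardSphereFlow (Torus.geometry (Fin 3)) (hsDiameter σ N) (N + 1))
    (τ r ϑ : ℝ) (φ : ℝ → T3 → ℝ) (z : Config (N + 1) (Fin 3) T3)
    (hfin : (collisionTimes (Torus.geometry (Fin 3)) (hsDiameter σ N) (fun s' => Φ.flow s' z) ∩
      Set.Icc 0 τ).Finite) :
    P2 σ N Φ τ r ϑ φ z - P1 σ N Φ τ r ϑ φ z =
      prodSum σ N Φ τ (fun w s i j => jump2 r ϑ (φ s) w i j - jump1 r ϑ (φ s) w i j) z :=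
  prodSum_sub σ N Φ τ _ _ z hfin

/-- Unfolding of the regularity event (definitional). [folklore] -/
theorem regular_iff (σ r τ η₁ ρ₁ θ₁ E₁ : ℝ)
    (Φ : HardSphereFlow (Torus.geometry (Fin 3)) (hsDiameter σ N) (N + 1)) (z : Config (N + 1) (Fin 3) T3) :
    Regular σ r τ η₁ ρ₁ θ₁ E₁ Φ z ↔ ∀ s ∈ Set.Icc (0 : ℝ) τ, ∀ x : T3,
      ρ₁ ≤ mollDensity r (Φ.flow s z) x ∧ σ ^ 3 * mollDensity r (Φ.flow s z) x ≤ η₁ ∧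
        θ₁ ≤ mollTemperature r (Φ.flow s z) x ∧ mollKineticEnergy r (Φ.flow s z) x ≤ E₁ :=
  Iff.rfl

/-- The S-mark vanishes on the post-collisional hemisphere `(w − v)·n ≤ 0`. [folklore] -/
theorem sMark_eq_zero_of_inner_nonpos (k : Fin 3) {n v w : V3} (h : ⟪w - v, n⟫_ℝ ≤ 0) :
    sMark k (n, v, w) = 0 := by
  unfold sMark
  rw [max_eq_right h, zero_mul]

/-- **The S-mark is the collisional transfer of kinetic energy** (times `n_k`): for a unit normal `n` and an
approaching pair, `(w − v)·n ≥ 0`, the elastic reflection `v′ = v − ((v − w)·n) n` gives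
`|v′|² − |v|² = ((w − v)·n)((v + w)·n)`, hence `Ξ_S^k(n, v, w) = (|v′|² − |v|²) n_k`
(Chapman–Cowling §16.6, `ψ = ½mc²`). [cite: ChapmanCowling1970, §16.6] -/
theorem sMark_eq_of_inner_nonneg (k : Fin 3) {n v w : V3} (hn : ‖n‖ = 1) (h : 0 ≤ ⟪w - v, n⟫_ℝ) :
    sMark k (n, v, w) = (‖(reflectVel n (v, w)).1‖ ^ 2 - ‖v‖ ^ 2) * n k := by
  unfold sMark
  rw [max_eq_left h]
  have hvv : ‖(reflectVel n (v, w)).1‖ ^ 2 - ‖v‖ ^ 2 = ⟪w - v, n⟫_ℝ * ⟪w + v, n⟫_ℝ := by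
    simp only [reflectVel, hn, one_pow, div_one]
    rw [norm_sub_sq_real, norm_smul, Real.norm_eq_abs, hn, mul_one, sq_abs, inner_smul_right]
    have h1 : ⟪v - w, n⟫_ℝ = ⟪v, n⟫_ℝ - ⟪w, n⟫_ℝ := inner_sub_left v w n
    have h2 : ⟪w - v, n⟫_ℝ = ⟪w, n⟫_ℝ - ⟪v, n⟫_ℝ := inner_sub_left w v n
    have h3 : ⟪w + v, n⟫_ℝ = ⟪w, n⟫_ℝ + ⟪v, n⟫_ℝ := inner_add_left w v n
    rw [h1, h2, h3]
    ring
  rw [hvv]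
  ring

end KineticEntropyBalance

end Literature.MathematicalPhysics.KineticTheory

end
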